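import Literature.Computability.MetaComplexity.AvgCaseDerandomization
import Literature.Computability.Complexity.PRGDerandomizationPromise
import HarnessLib

/-!
# Buhrman–Fortnow–Pavan, Thm. 3.1 (promise form): the derandomization step, proved

Sibling proof file of `AvgCaseDerandomization.lean` for the named fact
`BuhrmanFortnowPavan2004_PromiseBPP'_subset_PromiseP` (*if `DistNP ⊆ AvgP` then
`Promise-BPP = Promise-P`*; Buhrman–Fortnow–Pavan 2005, Thm. 3.1, in the promise form quoted by
Hirahara, ECCC TR18-138, proof of Cor. 4.23). The printed proof of Thm. 3.1 (BFP, pp. 5–6) has two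
parts:

1. (first sentence) "Suppose that there exists a language `A` in `E` and an `ε` such that for almost
   every `n`, `Aₙ` has circuit complexity at least `2^{εn}`, then by Theorem 3.2
   [Impagliazzo–Wigderson 1997] we have that pseudorandom generators exist and we are done";
2. (the body, "We will show that indeed there exists such a hard language in `E`") under
   `DistNP ⊆ AvgP`, from the contrary assumption "for every `ε > 0` and `A ∈ E`, `Aₙ` has circuits of
   size `2^{εn}` infinitely often" a contradiction is derived through Lemma 3.4 (BFLS/PS
   probabilistically checkable proofs ⟹ `2^{εn}`-time Merlin–Arthur protocols agreeing with `A`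
   infinitely often), Thm. 3.6 / Lemma 3.7 (Köbler–Schuler: under the average-case hypothesis the
   protocol is derandomised nondeterministically from a certified hard truth table), Thm. 3.5
   (Ben-David–Chor–Goldreich–Luby: `E = NE`), Impagliazzo–Kabanets–Wigderson (`E = NE ⟹
   NTIME(2ⁿ) ⊆ DTIME(2^{en})` for a fixed `e`) and a diagonal language in `DTIME(2^{dn})`.

This file PROVES part 1 in the tree's vocabulary, i.e. reduces the named fact to part 2:

* **`BuhrmanFortnowPavan2004_PromiseBPP'_subset_PromiseP_of_avgHardE`** — the fact follows from
  its core in AVERAGE-case form: `DistNP ⊆ AvgP ⟹` some `L ∈ E` is `2^{εn}`-hard on average for all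
  large `n` (`AvgHardAtLeast`, Arora–Barak Def. 19.1); the derandomization is Nisan–Wigderson's
  (`PromiseBPP'_subset_PromiseP_of_avgHard_E`, `PRGDerandomizationPromise.lean`: the quick generator of
  `NWQuickPRG.lean` and the promise form of Arora–Barak Lemma 20.3);
* **`BuhrmanFortnowPavan2004_PromiseBPP'_subset_PromiseP_of_hardE`** — the fact follows from its
  core AS PRINTED (worst-case hardness: `2^{εn} ≤ L.circuitSize n` for all large `n`, some `L ∈ E`,
  `ε > 0` — literally the hypothesis of the tree's named fact `impagliazzo_wigderson`, pnp.S24)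
  together with hardness amplification inside `E` (Impagliazzo–Wigderson 1997, Thm. 1), the latter
  stated as the explicit hypothesis `hamp` in exactly the shape of
  `impagliazzo_wigderson_of_hardnessAmplification` (`CircuitLowerBoundsIW.lean`), so that one proof
  of amplification serves both named facts.

Neither hypothesis is vendored as a named fact (D-0026): part 2 is the remaining proof obligation of
the discharge `BuhrmanFortnowPavan2004_PromiseBPP'_subset_PromiseP_holds`, to be proved as theorems
in sibling files; see the module docstring of `AvgCaseDerandomization.lean` for the comparison of
BFP's Levin-style hypothesis with the library's `DistNP ⊆ AvgP`.

## References

* H. Buhrman, L. Fortnow, A. Pavan, *Some results on derandomization*, Theory Comput. Syst. 38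
  (2005) 211–227, Thm. 3.1 and its proof (pp. 5–6 of the authors' version), Thm. 3.2, Lemma 3.4,
  Thm. 3.5, Thm. 3.6, Lemma 3.7 [BuhrmanFortnowPavan2004].
* R. Impagliazzo, A. Wigderson, *P = BPP if E requires exponential circuits: derandomizing the XOR
  lemma*, STOC 1997, Thms. 1–2 [ImpagliazzoWigderson1997].
* N. Nisan, A. Wigderson, *Hardness vs randomness*, JCSS 49 (1994), Thm. 3 (1) [NisanWigderson1994].
* S. Hirahara, ECCC TR18-138 rev. 1 (2019), proof of Cor. 4.23 [Hirahara2018] (the consumer).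
-/

namespace Literature.Computability.MetaComplexity

open _root_.Computability Complexity Filter

/-- **BFP Thm. 3.1 from its core, average-case form.** If `DistNP ⊆ AvgP` yields a language in
`E` that is `2^{εn}`-hard on average for all large `n`, then `DistNP ⊆ AvgP ⟹ PromiseBPP' ⊆ PromiseP`
(Nisan–Wigderson derandomization in promise form, `PromiseBPP'_subset_PromiseP_of_avgHard_E`).
[cite: BuhrmanFortnowPavan2004, Thm. 3.1 (proof, first sentence) and Thm. 3.2]
[cite: NisanWigderson1994, Thm. 3 (1)] -/
theorem BuhrmanFortnowPavan2004_PromiseBPP'_subset_PromiseP_of_avgHardE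
    (hcore : DistNP ⊆ AvgP → ∃ L ∈ E, ∃ ε : ℝ, 0 < ε ∧
      ∀ᶠ n : ℕ in atTop, AvgHardAtLeast (L.sliceFn n) ((2 : ℝ) ^ (ε * n))) :
    BuhrmanFortnowPavan2004_PromiseBPP'_subset_PromiseP := by
  intro hD
  obtain ⟨L, hL, ε, hε, hhard⟩ := hcore hD
  exact PromiseBPP'_subset_PromiseP_of_avgHard_E hL hε hhard

/-- **BFP Thm. 3.1 from its core as printed** ("there exists a language `A` in `E` and an `ε`
such that for almost every `n`, `Aₙ` has circuit complexity at least `2^{εn}`" under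
`DistNP ⊆ AvgP`: hypothesis `hcore`, the body of BFP's proof) **and Impagliazzo–Wigderson's
Thm. 1** (hardness amplification inside `E`: hypothesis `hamp`, in the shape of
`impagliazzo_wigderson_of_hardnessAmplification`). [cite: BuhrmanFortnowPavan2004, Thm. 3.1 (proof) and Thm. 3.2]
[cite: ImpagliazzoWigderson1997, Thms. 1–2] -/
theorem BuhrmanFortnowPavan2004_PromiseBPP'_subset_PromiseP_of_hardE
    (hcore : DistNP ⊆ AvgP → ∃ L ∈ E, ∃ ε : ℝ, 0 < ε ∧
      ∀ᶠ n : ℕ in atTop, (2 : ℝ) ^ (ε * n) ≤ (L.circuitSize n : ℝ))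
    (hamp : (∃ L ∈ E, ∃ ε : ℝ, 0 < ε ∧ ∀ᶠ n : ℕ in atTop, (2 : ℝ) ^ (ε * n) ≤ (L.circuitSize n : ℝ)) →
      ∃ L' ∈ E, ∃ ε' : ℝ, 0 < ε' ∧
        ∀ᶠ n : ℕ in atTop, AvgHardAtLeast (L'.sliceFn n) ((2 : ℝ) ^ (ε' * n))) :
    BuhrmanFortnowPavan2004_PromiseBPP'_subset_PromiseP :=
  BuhrmanFortnowPavan2004_PromiseBPP'_subset_PromiseP_of_avgHardE fun hD => hamp (hcore hD)

end Literature.Computability.MetaComplexity
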